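import Literature.NumberTheory.Irrationality.FischlerRivoal2003.BalancedPadeApproximants
import HarnessLib

/-!
# Fischler–Rivoal 2003, §2: the partial-fraction dictionary behind the Padé problems (8) and (19)

Topic `Literature/NumberTheory/Irrationality/FischlerRivoal2003`. Source: S. Fischler, T. Rivoal, *Approximants
de Padé et séries hypergéométriques équilibrées*, J. Math. Pures Appl. **82** (2003) 1369–1394 [FischlerRivoal2003],
§2 pp. 1375–1379 (read on the page: held text `paper:doi-10-1016-s0021-7824-03-00027-8`, p0008–p0011). This file
PROVES the algebraic machinery of the proof of Théorème 1 (p. 1376): "Fixons les notations suivantes … Pour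
`j ∈ {1, …, a}` on écrit `P_j(z) = Σ_{t=0}^{n} p_{j,t} z^t`. … Pour `k ≥ 1`, le coefficient de `z^{−k}` dans cette série
est donné par la fraction rationnelle `A(k) = Σ_{j=1}^{a} Σ_{t=0}^{n} p_{j,t}/(t+k)^j` (14) en la variable `k`, qu'on
peut aussi écrire sous la forme `Q(k)/(k)_{n+1}^a` où le polynôme `Q(k)` est de degré strictement inférieur à
`a(n+1)` … D'après l'unicité de la décomposition en éléments simples, la donnée de `P_1, …, P_a` est équivalente à la
donnée du polynôme `Q`."

## Contents (all PROVED; no named fact)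
* `PF.poly n a p` — the polynomial `Q` attached to the array `p o t = p_{o+1,t}` (`o < a`, `t ≤ n`), written as
  `Q = Σ_{o,t} p_{o+1,t} (X+t)^{a-1-o} ∏_{t' ≤ n, t' ≠ t} (X+t')^a`, so that `Q(k)/∏_{t ≤ n}(k+t)^a = A(k)`
  (`PF.aval_mul_den`); `natDegree Q < a(n+1)` (`PF.natDegree_poly_lt`);
* "l'unicité de la décomposition en éléments simples": `PF.poly` is injective on arrays (`PF.eq_zero_of_poly_eq_zero`)
  and every `Q` of degree `< a(n+1)` is attained (`PF.exists_array_of_natDegree_lt`, by a dimension count);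
* the top-order coefficients `p_{a,t} = Q(−t)/∏_{t' ≠ t}(t'−t)^a` (`PF.poly_eval_neg_natCast`), which is how (10) and
  (21) are "déduit facilement … en calculant les coefficients `p_{a,t}` grâce à (14)";
* the expansion of `A(k)` at infinity, `A(k) = Σ_{d ≥ 1} A_d k^{−d}` (16)–(17), as the power series `PF.hat n a p` in
  `v = 1/k`, with `∏_t (1 + t v)^a · hat = X^{·}`-reflection of `Q` (`PF.coe_reflect_poly`) and hence
  "`deg Q ≤ D` ⟺ `A_d = 0` pour `d ≤ a(n+1) − D − 1`" in the form `PF.natDegree_poly_le_iff_le_order_hat`;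
* the reflection `k ↦ −k−n` of the dictionary (`PF.poly_reflectArr`), used for Proposition 1 and (22);
* the coefficients of the three expansions of `IsPadeSolution` in terms of `A`: (13) `[w^{n+k}] = A(k)`
  (`coeff_expansionAtInfinity_add`), (15) `[z^{n+k}] = A(−n−k)` (`coeff_expansionAtZero_add`), and the condition at
  `z = 1` through the derivation `θ = −(1−u) d/du` of `ℂ⟦u⟧` (Lemme 3 / Proposition 2 in the form
  `constantCoeff (θ^m R) = (−1)^m A_{m+1}`, `PF.constantCoeff_theta_iterate_expansionAtOne`, and
  `atOne_iff_natDegree_le`). DEVIATION (named): the source proves Proposition 2 by the substitution `z = e^x`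
  (first proof) or by a contour integral (second proof); here the same coefficient identity is obtained with the
  derivation `θ`, which acts on `z^t log^{j-1}(z)/(j-1)!` by `t·(same) + z^t log^{j-2}(z)/(j-2)!`, avoiding
  composition of formal power series.

HONEST FRAMING (cells pub-zeta5 / zeta5-irr): pure algebra of the Padé problems; nothing here is a claim about
`ζ(5)`.
-/

noncomputable section

open Finset Polynomial

namespace Literature.NumberTheory.Irrationality.FischlerRivoal2003

namespace PF

/-! ## The dictionary `(p_{j,t}) ↔ Q` -/

/-- The basis element `T_{o,t} = (X + t)^{a-1-o} ∏_{t' ≤ n, t' ≠ t} (X + t')^a` of the dictionary: the numerator of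
`1/(k+t)^{o+1}` over the common denominator `(k)_{n+1}^a = ∏_{t' ≤ n} (k+t')^a`.
[cite: FischlerRivoal2003, §2 eq. (14) p. 1376] -/
def term (n a o t : ℕ) : ℂ[X] :=
  (X + C (t : ℂ)) ^ (a - 1 - o) * ∏ t' ∈ (range (n + 1)).erase t, (X + C (t' : ℂ)) ^ a

/-- The polynomial `Q` of an array `p` (`p o t = p_{o+1,t}`, the coefficient of `1/(k+t)^{o+1}`; only `o < a`,
`t ≤ n` are read): `Q = Σ_{o<a} Σ_{t≤n} p_{o+1,t} T_{o,t}`, so that `A(k) = Q(k)/(k)_{n+1}^a`.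
[cite: FischlerRivoal2003, §2 eq. (14) p. 1376] -/
def poly (n a : ℕ) (p : ℕ → ℕ → ℂ) : ℂ[X] :=
  ∑ o ∈ range a, ∑ t ∈ range (n + 1), C (p o t) * term n a o t

/-- The rational function (14), `A(k) = Σ_{j=1}^{a} Σ_{t=0}^{n} p_{j,t}/(t+k)^j`, evaluated at a complex `k`.
[cite: FischlerRivoal2003, §2 eq. (14) p. 1376] -/
def aval (n a : ℕ) (p : ℕ → ℕ → ℂ) (k : ℂ) : ℂ :=
  ∑ o ∈ range a, ∑ t ∈ range (n + 1), p o t / (k + t) ^ (o + 1)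

/-- The common denominator `(k)_{n+1}^a = ∏_{t ≤ n} (k+t)^a`. [cite: FischlerRivoal2003, §2 eq. (14) p. 1376] -/
def den (n a : ℕ) (k : ℂ) : ℂ := ∏ t ∈ range (n + 1), (k + t) ^ a

/-- Degree of a basis element: `deg T_{o,t} ≤ a(n+1) − 1 − o`. [cite: FischlerRivoal2003, §2 (14) p. 1376] -/
theorem natDegree_term_le {n a o t : ℕ} (ho : o < a) (ht : t ∈ range (n + 1)) :
    (term n a o t).natDegree ≤ a * (n + 1) - 1 - o := by
  unfold term
  have h1 : ((X + C (t : ℂ)) ^ (a - 1 - o)).natDegree ≤ a - 1 - o := by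
    rw [natDegree_pow, natDegree_X_add_C, mul_one]
  have h2 : (∏ t' ∈ (range (n + 1)).erase t, (X + C (t' : ℂ)) ^ a).natDegree ≤ a * n := by
    refine (natDegree_prod_le _ _).trans ?_
    refine (sum_le_sum (g := fun _ => a) fun i _ => ?_).trans ?_
    · rw [natDegree_pow, natDegree_X_add_C, mul_one]
    · rw [sum_const, card_erase_of_mem ht, card_range, smul_eq_mul, Nat.add_sub_cancel, Nat.mul_comm]
  refine (natDegree_mul_le).trans ?_
  have : a - 1 - o + a * n = a * (n + 1) - 1 - o := by
    have : 1 + o ≤ a := by omega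
    rw [Nat.mul_succ]
    omega
  omega

/-- `deg Q < a(n+1)` ("le polynôme `Q(k)` est de degré strictement inférieur à `a(n+1)`").
[cite: FischlerRivoal2003, §2 (after (14)) p. 1376] -/
theorem natDegree_poly_lt {n a : ℕ} (ha : 1 ≤ a) (p : ℕ → ℕ → ℂ) : (poly n a p).natDegree < a * (n + 1) := by
  have hN : 1 ≤ a * (n + 1) := by nlinarith
  suffices h : (poly n a p).natDegree ≤ a * (n + 1) - 1 by omega
  unfold poly
  refine natDegree_sum_le_of_forall_le _ _ fun o ho => ?_
  refine natDegree_sum_le_of_forall_le _ _ fun t ht => ?_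
  refine (natDegree_C_mul_le _ _).trans ?_
  exact (natDegree_term_le (mem_range.mp ho) ht).trans (by omega)

/-- `poly` is additive in the array. [cite: FischlerRivoal2003, §2 (14) p. 1376] -/
theorem poly_add (n a : ℕ) (p q : ℕ → ℕ → ℂ) : poly n a (p + q) = poly n a p + poly n a q := by
  simp only [poly, Pi.add_apply, C_add, add_mul, sum_add_distrib]

/-- `poly` is homogeneous in the array. [cite: FischlerRivoal2003, §2 (14) p. 1376] -/
theorem poly_smul (n a : ℕ) (c : ℂ) (p : ℕ → ℕ → ℂ) : poly n a (c • p) = c • poly n a p := by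
  simp only [poly, Pi.smul_apply, smul_eq_mul, C_mul, mul_assoc, smul_sum, smul_eq_C_mul]

/-- `poly` only reads the entries `o < a`, `t ≤ n`. [cite: FischlerRivoal2003, §2 (14) p. 1376] -/
theorem poly_congr {n a : ℕ} {p q : ℕ → ℕ → ℂ} (h : ∀ o < a, ∀ t ≤ n, p o t = q o t) :
    poly n a p = poly n a q := by
  unfold poly
  refine sum_congr rfl fun o ho => sum_congr rfl fun t ht => ?_
  rw [h o (mem_range.mp ho) t (Nat.lt_succ_iff.mp (mem_range.mp ht))]

/-- **`A(k) = Q(k)/(k)_{n+1}^a`** away from the poles: `A(k) · ∏_{t≤n}(k+t)^a = Q(k)`.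
[cite: FischlerRivoal2003, §2 eq. (14) p. 1376] -/
theorem aval_mul_den {n a : ℕ} (p : ℕ → ℕ → ℂ) (k : ℂ) (hk : ∀ t : ℕ, t ≤ n → k + t ≠ 0) :
    aval n a p k * den n a k = (poly n a p).eval k := by
  unfold aval den poly term
  simp only [eval_finsetSum, eval_mul, eval_C, eval_pow, eval_add, eval_X, eval_prod, sum_mul]
  refine sum_congr rfl fun o ho => sum_congr rfl fun t ht => ?_
  have ho' : o < a := mem_range.mp ho
  have ht' : t ≤ n := Nat.lt_succ_iff.mp (mem_range.mp ht)
  have hkt : k + t ≠ 0 := hk t ht'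
  rw [← mul_prod_erase (range (n + 1)) (fun t' => (k + (t' : ℂ)) ^ a) ht]
  have hsplit : (k + (t : ℂ)) ^ a = (k + t) ^ (o + 1) * (k + t) ^ (a - 1 - o) := by
    rw [← pow_add]; congr 1; omega
  rw [hsplit]
  field_simp

/-- **The top-order coefficients** (how (10) and (21) are read off from (14)): `Q(−t₀) = p_{a,t₀} · ∏_{t' ≠ t₀}(t'−t₀)^a`.
[cite: FischlerRivoal2003, §2 (proof of Théorème 1, "On en déduit facilement (10) en calculant les coefficients
`p_{a,t}` grâce à (14)") p. 1376] -/
theorem poly_eval_neg_natCast {n a : ℕ} (ha : 1 ≤ a) (p : ℕ → ℕ → ℂ) {t₀ : ℕ} (ht₀ : t₀ ≤ n) :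
    (poly n a p).eval (-(t₀ : ℂ)) = p (a - 1) t₀ * ∏ t' ∈ (range (n + 1)).erase t₀, ((t' : ℂ) - t₀) ^ a := by
  have ht₀' : t₀ ∈ range (n + 1) := mem_range.mpr (Nat.lt_succ_of_le ht₀)
  unfold poly
  rw [eval_finsetSum, sum_eq_single (a - 1)]
  · rw [eval_finsetSum, sum_eq_single t₀]
    · simp only [term, eval_mul, eval_C, eval_pow, eval_add, eval_X, eval_prod, Nat.sub_self, pow_zero, one_mul]
      refine congrArg _ (prod_congr rfl fun t' _ => ?_)
      ring
    · intro t ht hne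
      have hmem : t₀ ∈ (range (n + 1)).erase t := mem_erase.mpr ⟨hne.symm, ht₀'⟩
      simp only [term, eval_mul, eval_C, eval_pow, eval_add, eval_X, eval_prod]
      rw [← mul_prod_erase _ _ hmem]
      simp [zero_pow (by omega : a ≠ 0)]
    · intro h; exact absurd ht₀' h
  · intro o ho hne
    have ho' : o < a := mem_range.mp ho
    rw [eval_finsetSum]
    refine sum_eq_zero fun t ht => ?_
    rcases eq_or_ne t t₀ with rfl | hne'
    · simp only [term, eval_mul, eval_C, eval_pow, eval_add, eval_X]
      rw [show (-(t : ℂ) + t) = 0 by ring, zero_pow (by omega : a - 1 - o ≠ 0)]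
      simp
    · have hmem : t₀ ∈ (range (n + 1)).erase t := mem_erase.mpr ⟨hne'.symm, ht₀'⟩
      simp only [term, eval_mul, eval_C, eval_pow, eval_add, eval_X, eval_prod]
      rw [← mul_prod_erase _ _ hmem]
      simp [zero_pow (by omega : a ≠ 0)]
  · intro h
    exact absurd (mem_range.mpr (by omega : a - 1 < a)) h

/-- `∏_{j < m} (m − j) = m!` (over `ℂ`). [folklore] -/
private theorem prod_range_natCast_sub (m : ℕ) : ∏ j ∈ range m, ((m : ℂ) - j) = (m.factorial : ℂ) := by
  induction m with
  | zero => simp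
  | succ m ih =>
    rw [prod_range_succ', Nat.factorial_succ]
    push_cast
    have : ∏ j ∈ range m, ((m : ℂ) + 1 - ((j : ℂ) + 1)) = ∏ j ∈ range m, ((m : ℂ) - j) := by
      refine prod_congr rfl fun j _ => ?_
      ring
    rw [this, ih]
    ring

/-- The product of the differences: `∏_{t' ≤ n, t' ≠ t₀} (t' − t₀) = (−1)^{t₀} t₀! (n − t₀)!`.
[cite: FischlerRivoal2003, Théorème 1 (10) p. 1373 (the factor `k!^a (n−k)!^a`)] -/
theorem prod_erase_sub (n : ℕ) {t₀ : ℕ} (ht₀ : t₀ ≤ n) :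
    ∏ t' ∈ (range (n + 1)).erase t₀, ((t' : ℂ) - t₀) =
      (-1) ^ t₀ * (t₀.factorial : ℂ) * ((n - t₀).factorial : ℂ) := by
  have hset : (range (n + 1)).erase t₀ = range t₀ ∪ Ico (t₀ + 1) (n + 1) := by
    ext x
    simp only [mem_erase, mem_range, mem_union, mem_Ico]
    omega
  have hdisj : Disjoint (range t₀) (Ico (t₀ + 1) (n + 1)) := by
    rw [disjoint_left]
    intro x hx hx'
    simp only [mem_range] at hx
    simp only [mem_Ico] at hx'
    omega
  rw [hset, prod_union hdisj, prod_Ico_eq_prod_range, show n + 1 - (t₀ + 1) = n - t₀ by omega]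
  have h1 : ∏ t' ∈ range t₀, ((t' : ℂ) - t₀) = (-1) ^ t₀ * (t₀.factorial : ℂ) := by
    calc ∏ t' ∈ range t₀, ((t' : ℂ) - t₀) = ∏ t' ∈ range t₀, ((-1) * ((t₀ : ℂ) - t')) :=
          prod_congr rfl fun j _ => by ring
      _ = (-1) ^ t₀ * ∏ t' ∈ range t₀, ((t₀ : ℂ) - t') := by
          rw [prod_mul_distrib, prod_const, card_range]
      _ = (-1) ^ t₀ * (t₀.factorial : ℂ) := by rw [prod_range_natCast_sub]
  have h2 : ∏ i ∈ range (n - t₀), (((t₀ + 1 + i : ℕ) : ℂ) - t₀) = ((n - t₀).factorial : ℂ) := by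
    rw [← Finset.prod_range_add_one_eq_factorial, Nat.cast_prod]
    refine prod_congr rfl fun i _ => ?_
    push_cast; ring
  rw [h1, h2]

/-! ## "L'unicité de la décomposition en éléments simples": injectivity of `p ↦ Q` -/

/-- If `Q = 0` then every `p_{j,t}` vanishes (`1 ≤ j ≤ a`, `t ≤ n`). Proof: modulo `(X+t₀)^a` only the terms with
`t = t₀` survive, `(X+t₀)^a` is coprime to `∏_{t'≠t₀}(X+t')^a`, and a polynomial of degree `< a` divisible by
`(X+t₀)^a` is zero. [cite: FischlerRivoal2003, §2 ("D'après l'unicité de la décomposition en éléments simples")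
p. 1376] -/
theorem eq_zero_of_poly_eq_zero {n a : ℕ} (ha : 1 ≤ a) {p : ℕ → ℕ → ℂ} (h : poly n a p = 0) :
    ∀ o < a, ∀ t ≤ n, p o t = 0 := by
  intro o₀ ho₀ t₀ ht₀
  have ht₀' : t₀ ∈ range (n + 1) := mem_range.mpr (Nat.lt_succ_of_le ht₀)
  -- the local numerator at the pole `-t₀` and its cofactor
  set V : ℂ[X] := ∑ o ∈ range a, C (p o t₀) * (X + C (t₀ : ℂ)) ^ (a - 1 - o) with hV
  set U : ℂ[X] := ∏ t' ∈ (range (n + 1)).erase t₀, (X + C (t' : ℂ)) ^ a with hU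
  set B : ℂ[X] := (X + C (t₀ : ℂ)) ^ a with hB
  -- `poly = V * U + B * (rest)`
  have hdecomp : B ∣ poly n a p - V * U := by
    have hVU : V * U = ∑ o ∈ range a, C (p o t₀) * term n a o t₀ := by
      rw [hV, sum_mul]
      refine sum_congr rfl fun o _ => ?_
      rw [term, hU, mul_assoc]
    unfold poly
    rw [sum_comm, ← add_sum_erase (range (n + 1)) _ ht₀', hVU, add_sub_cancel_left]
    refine dvd_sum fun t ht => dvd_sum fun o _ => ?_
    have hne : t ≠ t₀ := (mem_erase.mp ht).1
    have hmem : t₀ ∈ (range (n + 1)).erase t := mem_erase.mpr ⟨hne.symm, ht₀'⟩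
    refine Dvd.dvd.mul_left ?_ _
    rw [term, ← mul_prod_erase _ _ hmem, hB]
    exact Dvd.dvd.mul_left (dvd_mul_right _ _) _
  rw [h, zero_sub, dvd_neg] at hdecomp
  -- coprimality of `B` and `U`
  have hcop : IsCoprime B U := by
    rw [hB, hU]
    refine IsCoprime.pow_left (IsCoprime.prod_right fun t' ht' => IsCoprime.pow_right ?_)
    have hne : t' ≠ t₀ := (mem_erase.mp ht').1
    have e1 : (X + C (t₀ : ℂ)) = X - C (-(t₀ : ℂ)) := by rw [map_neg]; ring
    have e2 : (X + C (t' : ℂ)) = X - C (-(t' : ℂ)) := by rw [map_neg]; ring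
    rw [e1, e2]
    refine isCoprime_X_sub_C_of_isUnit_sub (isUnit_iff_ne_zero.mpr ?_)
    intro h0
    apply hne
    have : ((t' : ℂ)) = t₀ := by linear_combination h0
    exact_mod_cast this
  have hBV : B ∣ V := hcop.dvd_of_dvd_mul_right hdecomp
  -- degree comparison forces `V = 0`
  have hVdeg : V.natDegree < B.natDegree := by
    rw [hB, natDegree_pow, natDegree_X_add_C, mul_one]
    suffices hle : V.natDegree ≤ a - 1 by omega
    rw [hV]
    refine natDegree_sum_le_of_forall_le _ _ fun o _ => (natDegree_C_mul_le _ _).trans ?_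
    rw [natDegree_pow, natDegree_X_add_C, mul_one]
    omega
  have hV0 : V = 0 := by
    by_contra hne
    exact absurd (natDegree_le_of_dvd hBV hne) (not_le.mpr hVdeg)
  -- read off the coefficients after the shift `X ↦ X - t₀`
  set W : ℂ[X] := ∑ o ∈ range a, C (p o t₀) * X ^ (a - 1 - o) with hW
  have hWV : W = V.comp (X - C (t₀ : ℂ)) := by
    rw [hV, hW]
    simp only [Polynomial.sum_comp, mul_comp, C_comp, pow_comp, add_comp, X_comp, sub_add_cancel]
  have hW0 : W = 0 := by rw [hWV, hV0, zero_comp]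
  have hcoeff : W.coeff (a - 1 - o₀) = p o₀ t₀ := by
    rw [hW, finsetSum_coeff, sum_eq_single o₀]
    · simp
    · intro o ho hne
      rw [coeff_C_mul, coeff_X_pow, if_neg]
      · simp
      · have := mem_range.mp ho; omega
    · intro hmem; exact absurd (mem_range.mpr ho₀) hmem
  rw [← hcoeff, hW0, coeff_zero]

/-- Injectivity of the dictionary on arrays: equal `Q` ⇒ equal `p_{j,t}` (`j ≤ a`, `t ≤ n`).
[cite: FischlerRivoal2003, §2 ("la donnée de `P_1, …, P_a` est équivalente à la donnée du polynôme `Q`") p. 1376] -/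
theorem arr_eq_of_poly_eq {n a : ℕ} (ha : 1 ≤ a) {p q : ℕ → ℕ → ℂ} (h : poly n a p = poly n a q) :
    ∀ o < a, ∀ t ≤ n, p o t = q o t := by
  intro o ho t ht
  have h0 : poly n a (p - q) = 0 := by
    rw [show p - q = p + (-1 : ℂ) • q by ext; simp; ring, poly_add, poly_smul, h]
    simp
  have := eq_zero_of_poly_eq_zero ha h0 o ho t ht
  simpa [sub_eq_zero] using this

/-! ## Surjectivity onto `deg Q < a(n+1)` (dimension count) -/

/-- The dictionary as a linear map from arrays indexed by `Fin a × Fin (n+1)` to polynomials of degree `< a(n+1)`.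
[cite: FischlerRivoal2003, §2 ("la donnée de `P_1, …, P_a` est équivalente à la donnée du polynôme `Q`") p. 1376] -/
def polyLin (n a : ℕ) : (Fin a × Fin (n + 1) → ℂ) →ₗ[ℂ] degreeLT ℂ (a * (n + 1)) where
  toFun v := ⟨∑ x : Fin a × Fin (n + 1), C (v x) * term n a x.1 x.2, by
    refine Submodule.sum_mem _ fun x _ => ?_
    rw [← smul_eq_C_mul]
    refine Submodule.smul_mem _ _ (mem_degreeLT.mpr ?_)
    have ho : (x.1 : ℕ) < a := x.1.isLt
    have hN : 1 ≤ a * (n + 1) := by nlinarith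
    have hle := natDegree_term_le (n := n) ho (mem_range.mpr x.2.isLt)
    refine (degree_le_natDegree).trans_lt ?_
    exact_mod_cast (show (term n a x.1 x.2).natDegree < a * (n + 1) by omega)⟩
  map_add' v w := by
    ext1
    simp only [Pi.add_apply, C_add, add_mul, sum_add_distrib, Submodule.coe_add]
  map_smul' c v := by
    ext1
    simp only [Pi.smul_apply, smul_eq_mul, C_mul, mul_assoc, RingHom.id_apply, Submodule.coe_smul,
      smul_sum, smul_eq_C_mul]

/-- The array `ℕ → ℕ → ℂ` underlying a `Fin`-indexed vector (zero outside the box). [folklore] -/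
private def ofFin {n a : ℕ} (v : Fin a × Fin (n + 1) → ℂ) : ℕ → ℕ → ℂ := fun o t =>
  if h : o < a ∧ t < n + 1 then v (⟨o, h.1⟩, ⟨t, h.2⟩) else 0

/-- `poly` of the underlying array is the `Fin`-indexed sum. [folklore] -/
private theorem poly_ofFin {n a : ℕ} (v : Fin a × Fin (n + 1) → ℂ) :
    poly n a (ofFin v) = ∑ x : Fin a × Fin (n + 1), C (v x) * term n a x.1 x.2 := by
  rw [Fintype.sum_prod_type, poly]
  rw [← Fin.sum_univ_eq_sum_range (fun o => ∑ t ∈ range (n + 1), C (ofFin v o t) * term n a o t) a]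
  refine Fintype.sum_congr _ _ fun o => ?_
  rw [← Fin.sum_univ_eq_sum_range (fun t => C (ofFin v o t) * term n a o t) (n + 1)]
  refine Fintype.sum_congr _ _ fun t => ?_
  simp [ofFin, o.isLt, t.isLt]

/-- The dictionary is injective (as a linear map). [cite: FischlerRivoal2003, §2 p. 1376] -/
theorem polyLin_injective {n a : ℕ} (ha : 1 ≤ a) : Function.Injective (polyLin n a) := by
  intro v w hvw
  have h : (polyLin n a v : ℂ[X]) = polyLin n a w := by rw [hvw]
  simp only [polyLin, LinearMap.coe_mk, AddHom.coe_mk] at h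
  rw [← poly_ofFin, ← poly_ofFin] at h
  funext x
  have := arr_eq_of_poly_eq ha h x.1 x.1.isLt x.2 (Nat.lt_succ_iff.mp x.2.isLt)
  simpa [ofFin, x.1.isLt, x.2.isLt] using this

/-- **Existence of partial fractions**: every `Q` with `deg Q < a(n+1)` is the polynomial of some array —
"qu'on peut aussi écrire sous la forme `Q(k)/(k)_{n+1}^a`", read backwards (injective linear map between spaces
of the same dimension `a(n+1)`). [cite: FischlerRivoal2003, §2 (after (14)) p. 1376] -/
theorem exists_array_of_natDegree_lt {n a : ℕ} (ha : 1 ≤ a) (Q : ℂ[X]) (hQ : Q.natDegree < a * (n + 1)) :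
    ∃ p : ℕ → ℕ → ℂ, poly n a p = Q := by
  haveI : FiniteDimensional ℂ (degreeLT ℂ (a * (n + 1))) :=
    LinearEquiv.finiteDimensional (degreeLTEquiv ℂ (a * (n + 1))).symm
  have hdim : Module.finrank ℂ (Fin a × Fin (n + 1) → ℂ) = Module.finrank ℂ (degreeLT ℂ (a * (n + 1))) := by
    rw [Module.finrank_fintype_fun_eq_card, (degreeLTEquiv ℂ (a * (n + 1))).finrank_eq,
      Module.finrank_fintype_fun_eq_card]
    simp
  have hsurj : Function.Surjective (polyLin n a) :=
    (LinearMap.injective_iff_surjective_of_finrank_eq_finrank hdim).mp (polyLin_injective ha)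
  have hQmem : Q ∈ degreeLT ℂ (a * (n + 1)) := by
    rw [mem_degreeLT]
    exact (degree_le_natDegree).trans_lt (by exact_mod_cast hQ)
  obtain ⟨v, hv⟩ := hsurj ⟨Q, hQmem⟩
  refine ⟨ofFin v, ?_⟩
  have := congrArg Subtype.val hv
  simp only [polyLin, LinearMap.coe_mk, AddHom.coe_mk] at this
  rw [poly_ofFin, this]


/-! ## The reflection `k ↦ −k−n` of the dictionary -/

/-- The array of the reflected family `(−1)^j zⁿ P_j(1/z)`: `p̃_{o,t} = (−1)^{o+1} p_{o,n−t}`.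
[cite: FischlerRivoal2003, Proposition 1 (proof: "la famille `((−1)^j zⁿ P_{j,σ,ρ}(1/z))`") p. 1374] -/
def reflectArr (n : ℕ) (p : ℕ → ℕ → ℂ) : ℕ → ℕ → ℂ := fun o t => (-1) ^ (o + 1) * p o (n - t)

/-- A linear factor under `X ↦ −X − n`: `(X + s) ↦ −(X + (n − s))` (`s ≤ n`). [folklore] -/
private theorem X_add_C_comp_neg (n : ℕ) {s : ℕ} (hs : s ≤ n) :
    (X + C (s : ℂ)).comp (-X - C (n : ℂ)) = -(X + C ((n - s : ℕ) : ℂ)) := by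
  rw [add_comp, X_comp, C_comp, Nat.cast_sub hs, map_sub]
  ring

/-- The basis elements under `X ↦ −X − n`: `T_{o,t}(−X−n) = (−1)^{a(n+1)} (−1)^{o+1} T_{o,n−t}(X)`.
[cite: FischlerRivoal2003, Proposition 1 (proof) p. 1374] -/
theorem term_comp_neg {n a o t : ℕ} (ho : o < a) (ht : t ∈ range (n + 1)) :
    (term n a o t).comp (-X - C (n : ℂ)) = (-1 : ℂ[X]) ^ (a * (n + 1)) * (-1) ^ (o + 1) * term n a o (n - t) := by
  have ht' : t ≤ n := Nat.lt_succ_iff.mp (mem_range.mp ht)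
  -- reindex the product over `(range (n+1)).erase t` by `s ↦ n - s`
  have hbij : ∏ s ∈ (range (n + 1)).erase (n - t), (X + C (s : ℂ)) ^ a =
      ∏ t' ∈ (range (n + 1)).erase t, (X + C ((n - t' : ℕ) : ℂ)) ^ a := by
    refine (prod_nbij' (fun t' => n - t') (fun s => n - s) ?_ ?_ ?_ ?_ ?_).symm
    · intro t' h
      simp only [mem_erase, mem_range, ne_eq] at h ⊢; omega
    · intro s hs
      simp only [mem_erase, mem_range, ne_eq] at hs ⊢; omega
    · intro t' h
      simp only [mem_erase, mem_range, ne_eq] at h; omega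
    · intro s hs
      simp only [mem_erase, mem_range, ne_eq] at hs; omega
    · intro t' _; rfl
  have hcard : ((range (n + 1)).erase t).card = n := by rw [card_erase_of_mem ht, card_range]; rfl
  have hprod : ∏ t' ∈ (range (n + 1)).erase t, ((X + C (t' : ℂ)) ^ a).comp (-X - C (n : ℂ)) =
      (-1) ^ (a * n) * ∏ s ∈ (range (n + 1)).erase (n - t), (X + C (s : ℂ)) ^ a := by
    rw [hbij, show (-1 : ℂ[X]) ^ (a * n) = ∏ t' ∈ (range (n + 1)).erase t, (-1 : ℂ[X]) ^ a by
      rw [prod_const, hcard, ← pow_mul, mul_comm], ← prod_mul_distrib]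
    refine prod_congr rfl fun t' h => ?_
    have h' : t' ≤ n := Nat.lt_succ_iff.mp (mem_range.mp (mem_erase.mp h).2)
    rw [pow_comp, X_add_C_comp_neg n h', neg_pow, mul_comm]
  rw [term, term, mul_comp, pow_comp, Polynomial.prod_comp, X_add_C_comp_neg n ht', hprod, neg_pow]
  have hexp : (-1 : ℂ[X]) ^ (a - 1 - o) * (-1) ^ (a * n) = (-1) ^ (a * (n + 1)) * (-1) ^ (o + 1) := by
    have hrel : (a - 1 - o + a * n) + 2 * (o + 1) = a * (n + 1) + (o + 1) := by
      have : o + 1 ≤ a := ho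
      have : a * (n + 1) = a * n + a := by ring
      omega
    have e1 : (-1 : ℂ[X]) ^ (a - 1 - o) * (-1) ^ (a * n) = (-1) ^ (a - 1 - o + a * n) := (pow_add _ _ _).symm
    have e2 : (-1 : ℂ[X]) ^ (a * (n + 1)) * (-1) ^ (o + 1) = (-1) ^ (a - 1 - o + a * n + 2 * (o + 1)) := by
      rw [hrel]; exact (pow_add _ _ _).symm
    rw [e1, e2]
    conv_rhs => rw [pow_add, pow_mul, neg_one_sq, one_pow, mul_one]
  linear_combination (X + C ((n - t : ℕ) : ℂ)) ^ (a - 1 - o) *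
    (∏ s ∈ (range (n + 1)).erase (n - t), (X + C (s : ℂ)) ^ a) * hexp

/-- **The reflected family has the reflected `Q`**: `Q̃(X) = (−1)^{a(n+1)} Q(−X−n)` for the array
`p̃_{o,t} = (−1)^{o+1} p_{o,n−t}` — the dictionary form of "En changeant `z` en `1/z`" (proof of Proposition 1) and
of (15) (`A` of the reflected family is `A(−k−n)`).
[cite: FischlerRivoal2003, Proposition 1 (proof) p. 1374 and Lemme 2 (15) p. 1377] -/
theorem poly_reflectArr (n a : ℕ) (p : ℕ → ℕ → ℂ) :
    poly n a (reflectArr n p) = (-1 : ℂ[X]) ^ (a * (n + 1)) * (poly n a p).comp (-X - C (n : ℂ)) := by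
  unfold poly
  rw [Polynomial.sum_comp, mul_sum]
  refine sum_congr rfl fun o ho => ?_
  have ho' : o < a := mem_range.mp ho
  rw [Polynomial.sum_comp, mul_sum]
  -- reindex `t ↦ n - t` on the left
  rw [← sum_nbij' (s := range (n + 1)) (t := range (n + 1)) (fun t => n - t) (fun s => n - s)
    (fun t h => by simp only [mem_range] at h ⊢; omega)
    (fun s hs => by simp only [mem_range] at hs ⊢; omega)
    (fun t h => by simp only [mem_range] at h; omega)
    (fun s hs => by simp only [mem_range] at hs; omega)
    (fun t _ => rfl)]
  refine sum_congr rfl fun t ht => ?_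
  have ht' : t ≤ n := Nat.lt_succ_iff.mp (mem_range.mp ht)
  rw [mul_comp, C_comp, term_comp_neg ho' ht, reflectArr, Nat.sub_sub_self ht', map_mul, map_pow, map_neg,
    map_one]
  have hsq : ((-1 : ℂ[X]) ^ (a * (n + 1))) ^ 2 = 1 := by
    rw [← pow_mul, mul_comm, pow_mul, neg_one_sq, one_pow]
  linear_combination (-((-1 : ℂ[X]) ^ (o + 1) * C (p o t) * term n a o (n - t))) * hsq

/-! ## The expansion of `A(k)` at infinity: `A(k) = Σ_{d ≥ 1} A_d k^{−d}` ((16)–(17)) -/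

/-- `(1 + t v)^{−(o+1)} = Σ_m binom(o+m, o) (−t)^m v^m`, the expansion at infinity of `1/(k+t)^{o+1}` in `v = 1/k`
without the factor `v^{o+1}` ("`1/(k+i)^j = Σ_{ℓ≥0} binom(ℓ+j−1, ℓ)(−i)^ℓ/k^{ℓ+j}`").
[cite: FischlerRivoal2003, §2 proof of Lemme 3 (display before (16)) p. 1377] -/
def geomInvPow (t o : ℕ) : PowerSeries ℂ :=
  PowerSeries.rescale (-(t : ℂ)) (PowerSeries.mk fun m => (((o + m).choose o : ℕ) : ℂ))

/-- Coefficients of `(1 + t v)^{−(o+1)}`. [cite: FischlerRivoal2003, §2 proof of Lemme 3 p. 1377] -/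
theorem coeff_geomInvPow (t o m : ℕ) :
    PowerSeries.coeff m (geomInvPow t o) = (-(t : ℂ)) ^ m * (((o + m).choose o : ℕ) : ℂ) := by
  simp [geomInvPow, PowerSeries.coeff_rescale]

/-- `(1 + t v)^{o+1} · (1 + t v)^{−(o+1)} = 1`. [cite: FischlerRivoal2003, §2 proof of Lemme 3 p. 1377] -/
theorem one_add_pow_mul_geomInvPow (t o : ℕ) :
    ((1 : PowerSeries ℂ) + PowerSeries.C (t : ℂ) * PowerSeries.X) ^ (o + 1) * geomInvPow t o = 1 := by
  have h : (PowerSeries.mk fun m => (((o + m).choose o : ℕ) : ℂ)) * (1 - PowerSeries.X) ^ (o + 1) = 1 :=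
    PowerSeries.mk_add_choose_mul_one_sub_pow_eq_one ℂ o
  have h2 : PowerSeries.rescale (-(t : ℂ))
      ((PowerSeries.mk fun m => (((o + m).choose o : ℕ) : ℂ)) * (1 - PowerSeries.X) ^ (o + 1)) = 1 := by
    rw [h, map_one]
  rw [map_mul, map_pow, map_sub, map_one, PowerSeries.rescale_X, map_neg] at h2
  rw [mul_comm, geomInvPow]
  convert h2 using 2
  ring

/-- The expansion at infinity `Â(v) = Σ_{d≥1} A_d v^d` of `A(k)` (`v = 1/k`), as a formal power series:
`Â = Σ_{o,t} p_{o+1,t} v^{o+1} (1 + t v)^{−(o+1)}`. [cite: FischlerRivoal2003, §2 eq. (16) p. 1377] -/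
def hat (n a : ℕ) (p : ℕ → ℕ → ℂ) : PowerSeries ℂ :=
  ∑ o ∈ range a, ∑ t ∈ range (n + 1), p o t • (PowerSeries.X ^ (o + 1) * geomInvPow t o)

/-- **The coefficients `A_d`** (17): `A_d = Σ_{j ≤ min(a,d)} Σ_{i ≤ n} (−1)^{d−j} binom(d−1, d−j) i^{d−j} p_{j,i}`,
here with `j = o+1`. [cite: FischlerRivoal2003, §2 eq. (17) p. 1378] -/
theorem coeff_hat (n a : ℕ) (p : ℕ → ℕ → ℂ) (d : ℕ) :
    PowerSeries.coeff d (hat n a p) = ∑ o ∈ range a, ∑ t ∈ range (n + 1),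
      if o + 1 ≤ d then p o t * ((-(t : ℂ)) ^ (d - 1 - o) * (((d - 1).choose o : ℕ) : ℂ)) else 0 := by
  simp only [hat, map_sum, PowerSeries.coeff_smul, PowerSeries.coeff_X_pow_mul', smul_eq_mul]
  refine sum_congr rfl fun o _ => sum_congr rfl fun t _ => ?_
  split_ifs with h
  · rw [coeff_geomInvPow, show o + (d - (o + 1)) = d - 1 by omega, show d - (o + 1) = d - 1 - o by omega]
  · rw [mul_zero]

/-- `A_0 = 0`: the expansion at infinity has no constant term. [cite: FischlerRivoal2003, §2 eq. (16) p. 1377] -/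
theorem coeff_zero_hat (n a : ℕ) (p : ℕ → ℕ → ℂ) : PowerSeries.coeff 0 (hat n a p) = 0 := by
  rw [coeff_hat]
  exact sum_eq_zero fun o _ => sum_eq_zero fun t _ => by simp

/-- The reversed denominator `∏_{t ≤ n} (1 + t v)^a = v^{a(n+1)} (1/v)_{n+1}^a`, as a power series.
[cite: FischlerRivoal2003, §2 eq. (14) p. 1376] -/
def denRev (n a : ℕ) : PowerSeries ℂ :=
  ∏ t ∈ range (n + 1), ((1 : PowerSeries ℂ) + PowerSeries.C (t : ℂ) * PowerSeries.X) ^ a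

/-- The reversed denominator has constant term `1`. [cite: FischlerRivoal2003, §2 eq. (14) p. 1376] -/
theorem constantCoeff_denRev (n a : ℕ) : PowerSeries.constantCoeff (denRev n a) = 1 := by
  simp [denRev, map_prod, map_pow]

/-- `reflect` over a finite sum. [folklore] -/
private theorem reflect_finset_sum {ι : Type*} (s : Finset ι) (f : ι → ℂ[X]) (N : ℕ) :
    reflect N (∑ i ∈ s, f i) = ∑ i ∈ s, reflect N (f i) := by
  classical
  induction s using Finset.induction_on with
  | empty => simp
  | insert i s hi ih => rw [sum_insert hi, sum_insert hi, reflect_add, ih]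

/-- `reflect m ((X + c)^m) = (1 + c X)^m`. [folklore] -/
private theorem reflect_X_add_C_pow (c : ℂ) (m : ℕ) : reflect m ((X + C c) ^ m) = (1 + C c * X) ^ m := by
  induction m with
  | zero =>
    rw [pow_zero, pow_zero, show (1 : ℂ[X]) = C 1 from (map_one C).symm, reflect_C]
    simp
  | succ m ih =>
    rw [pow_succ, reflect_mul _ _ (by rw [natDegree_pow, natDegree_X_add_C, mul_one]) (natDegree_X_add_C c).le,
      ih, pow_succ]
    congr 1
    rw [reflect_add, show (X : ℂ[X]) = X ^ 1 from (pow_one X).symm, reflect_monomial, reflect_C,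
      revAt_le (le_refl 1)]
    simp

/-- `reflect` over a finite product of polynomials of degree `≤ d`. [folklore] -/
private theorem reflect_finset_prod (s : Finset ℕ) (f : ℕ → ℂ[X]) (d : ℕ) (hf : ∀ i ∈ s, (f i).natDegree ≤ d) :
    reflect (s.card * d) (∏ i ∈ s, f i) = ∏ i ∈ s, reflect d (f i) := by
  classical
  induction s using Finset.induction_on with
  | empty =>
    rw [prod_empty, prod_empty, card_empty, zero_mul, show (1 : ℂ[X]) = C 1 from (map_one C).symm, reflect_C]
    simp
  | insert i s hi ih =>
    have hf' : ∀ i ∈ s, (f i).natDegree ≤ d := fun j hj => hf j (mem_insert_of_mem hj)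
    rw [prod_insert hi, prod_insert hi, card_insert_of_notMem hi, show (s.card + 1) * d = d + s.card * d by ring,
      reflect_mul _ _ (hf i (mem_insert_self i s)) ?_, ih hf']
    refine (natDegree_prod_le _ _).trans ?_
    refine (sum_le_sum fun j hj => hf' j hj).trans ?_
    simp

/-- The reflected basis element: `reflect_{a(n+1)} T_{o,t} = v^{o+1} (1 + t v)^{a−1−o} ∏_{t'≠t} (1 + t' v)^a`.
[cite: FischlerRivoal2003, §2 proof of Lemme 3 p. 1377] -/
theorem reflect_term {n a o t : ℕ} (ho : o < a) (ht : t ∈ range (n + 1)) :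
    reflect (a * (n + 1)) (term n a o t) =
      X ^ (o + 1) * ((1 + C (t : ℂ) * X) ^ (a - 1 - o) *
        ∏ t' ∈ (range (n + 1)).erase t, (1 + C (t' : ℂ) * X) ^ a) := by
  have hcard : ((range (n + 1)).erase t).card = n := by rw [card_erase_of_mem ht, card_range]; rfl
  have hdeg1 : ((X + C (t : ℂ)) ^ (a - 1 - o)).natDegree ≤ a - 1 - o := by
    rw [natDegree_pow, natDegree_X_add_C, mul_one]
  have hdegf : ∀ t' ∈ (range (n + 1)).erase t, ((X + C (t' : ℂ)) ^ a).natDegree ≤ a := fun t' _ => by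
    rw [natDegree_pow, natDegree_X_add_C, mul_one]
  have hdeg2 : (∏ t' ∈ (range (n + 1)).erase t, (X + C (t' : ℂ)) ^ a).natDegree ≤
      ((range (n + 1)).erase t).card * a :=
    (natDegree_prod_le _ _).trans ((sum_le_sum hdegf).trans (by simp))
  have hN : a * (n + 1) = (o + 1) + ((a - 1 - o) + ((range (n + 1)).erase t).card * a) := by
    have : o + 1 ≤ a := ho
    rw [hcard, Nat.mul_succ, Nat.mul_comm n a]; omega
  rw [hN, term, ← one_mul ((X + C (t : ℂ)) ^ (a - 1 - o) * _),
    reflect_mul _ _ (by simp) (natDegree_mul_le.trans (add_le_add hdeg1 hdeg2)),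
    reflect_mul _ _ hdeg1 hdeg2, reflect_finset_prod _ _ _ hdegf, reflect_X_add_C_pow]
  congr 1
  · rw [show (1 : ℂ[X]) = C 1 from (map_one C).symm, reflect_C, map_one, one_mul]
  · congr 1
    exact prod_congr rfl fun t' _ => reflect_X_add_C_pow _ _

/-- The ring-hom coercion `ℂ[X] → ℂ⟦X⟧` over finite sums. [folklore] -/
private theorem coe_finset_sum {ι : Type*} (s : Finset ι) (f : ι → ℂ[X]) :
    (((∑ i ∈ s, f i : ℂ[X])) : PowerSeries ℂ) = ∑ i ∈ s, ((f i : ℂ[X]) : PowerSeries ℂ) :=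
  map_sum (Polynomial.coeToPowerSeries.ringHom (R := ℂ)) f s

/-- The ring-hom coercion `ℂ[X] → ℂ⟦X⟧` over finite products. [folklore] -/
private theorem coe_finset_prod {ι : Type*} (s : Finset ι) (f : ι → ℂ[X]) :
    (((∏ i ∈ s, f i : ℂ[X])) : PowerSeries ℂ) = ∏ i ∈ s, ((f i : ℂ[X]) : PowerSeries ℂ) :=
  map_prod (Polynomial.coeToPowerSeries.ringHom (R := ℂ)) f s

/-- **`v^{a(n+1)} Q(1/v) = ∏_t (1 + t v)^a · Â(v)`**: the reflection of `Q` at level `a(n+1)` is the reversed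
denominator times the expansion at infinity — the formal content of "`A(k) = Σ_{d≥1} A_d/k^d` (16)".
[cite: FischlerRivoal2003, §2 eq. (16) p. 1377] -/
theorem coe_reflect_poly (n a : ℕ) (p : ℕ → ℕ → ℂ) :
    ((reflect (a * (n + 1)) (poly n a p) : ℂ[X]) : PowerSeries ℂ) = denRev n a * hat n a p := by
  unfold poly hat
  rw [reflect_finset_sum, coe_finset_sum, mul_sum]
  refine sum_congr rfl fun o ho => ?_
  rw [reflect_finset_sum, coe_finset_sum, mul_sum]
  refine sum_congr rfl fun t ht => ?_
  have ho' : o < a := mem_range.mp ho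
  rw [reflect_C_mul, reflect_term ho' ht]
  simp only [Polynomial.coe_mul, Polynomial.coe_C, Polynomial.coe_pow, Polynomial.coe_X, Polynomial.coe_add,
    Polynomial.coe_one, coe_finset_prod]
  -- `denRev = (1 + tX)^{a-1-o} (1 + tX)^{o+1} ∏_{t' ≠ t} (1 + t'X)^a`
  have hden : denRev n a = ((1 : PowerSeries ℂ) + PowerSeries.C (t : ℂ) * PowerSeries.X) ^ (a - 1 - o) *
      (((1 : PowerSeries ℂ) + PowerSeries.C (t : ℂ) * PowerSeries.X) ^ (o + 1)) *
        ∏ t' ∈ (range (n + 1)).erase t, ((1 : PowerSeries ℂ) + PowerSeries.C (t' : ℂ) * PowerSeries.X) ^ a := by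
    rw [denRev, ← mul_prod_erase _ _ ht, ← pow_add, show a - 1 - o + (o + 1) = a by omega]
  rw [hden, PowerSeries.smul_eq_C_mul]
  have hG := one_add_pow_mul_geomInvPow t o
  linear_combination (-(PowerSeries.C (p o t) * PowerSeries.X ^ (o + 1) *
    ((1 : PowerSeries ℂ) + PowerSeries.C (t : ℂ) * PowerSeries.X) ^ (a - 1 - o) *
      ∏ t' ∈ (range (n + 1)).erase t, ((1 : PowerSeries ℂ) + PowerSeries.C (t' : ℂ) * PowerSeries.X) ^ a)) * hG

/-- Degree of a polynomial of degree `< N` through its reflection at level `N`: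
`deg q ≤ D` iff the coefficients `0, …, N−D−1` of `reflect N q` vanish. [folklore] -/
private theorem natDegree_le_iff_coeff_reflect {q : ℂ[X]} {N D : ℕ} (hq : q.natDegree < N) :
    q.natDegree ≤ D ↔ ∀ i < N - D, (reflect N q).coeff i = 0 := by
  constructor
  · intro hD i hi
    rw [coeff_reflect, revAt_le (by omega : i ≤ N)]
    exact coeff_eq_zero_of_natDegree_lt (by omega)
  · intro h
    rw [natDegree_le_iff_coeff_eq_zero]
    intro m hm
    by_cases hmN : m < N
    · have := h (N - m) (by omega)
      rwa [coeff_reflect, revAt_le (by omega : N - m ≤ N), Nat.sub_sub_self hmN.le] at this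
    · exact coeff_eq_zero_of_natDegree_lt (by omega)

/-- **Lemme 3, dictionary form**: "`deg Q ≤ D`" iff "`A_d = 0` pour tout `d ∈ {1, …, a(n+1) − D − 1}`", here as
`deg Q ≤ D ⟺ (a(n+1) − D) ≤ order(Â)` (recall `A_0 = 0`). [cite: FischlerRivoal2003, Lemme 3 (proof, "La
condition `deg(Q) ≤ D` se traduit par : `A_d = 0` pour tout `d ∈ {1, …, a(n+1) − D − 1}`") p. 1378] -/
theorem natDegree_poly_le_iff_le_order_hat {n a : ℕ} (ha : 1 ≤ a) (p : ℕ → ℕ → ℂ) (D : ℕ) :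
    (poly n a p).natDegree ≤ D ↔ ((a * (n + 1) - D : ℕ) : ℕ∞) ≤ (hat n a p).order := by
  have hq := natDegree_poly_lt (n := n) ha p
  rw [natDegree_le_iff_coeff_reflect hq]
  have horder : (hat n a p).order = (((reflect (a * (n + 1)) (poly n a p) : ℂ[X]) : PowerSeries ℂ)).order := by
    rw [coe_reflect_poly, PowerSeries.order_mul]
    suffices h0 : (denRev n a).order = 0 by rw [h0, zero_add]
    have h1 : PowerSeries.coeff 0 (denRev n a) ≠ 0 := by
      rw [PowerSeries.coeff_zero_eq_constantCoeff_apply, constantCoeff_denRev]; exact one_ne_zero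
    have := PowerSeries.order_le 0 h1
    exact le_antisymm (by simpa using this) (by simp)
  rw [horder]
  constructor
  · intro h
    refine PowerSeries.nat_le_order _ _ fun i hi => ?_
    rw [Polynomial.coeff_coe]
    exact h i hi
  · intro h i hi
    have := PowerSeries.coeff_of_lt_order i (lt_of_lt_of_le (by exact_mod_cast hi) h)
    rwa [Polynomial.coeff_coe] at this


/-! ## The condition at `z = 1`: the derivation `θ = −(1−u) d/du` (Lemme 3 / Proposition 2)

In the variable `u = 1 − z` of `expansionAtOne`, `θ = z d/dz = −(1−u) d/du = (u − 1) d/du` acts on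
`z^t = (1−u)^t` by `θ z^t = t z^t` and on `log z = logFPS` by `θ log z = 1`; hence on
`G_{t,i} = z^t log^i(z)/i!` by `θ G_{t,i} = t G_{t,i} + G_{t,i−1}`, and `constantCoeff (θ^m G_{t,i}) = binom(m,i) t^{m−i}`.
Summing against the coefficients `(−1)^{j−1} p_{j,t}` of `R` gives `constantCoeff (θ^m R) = (−1)^m A_{m+1}` with the
`A_d` of (17) — the coefficient identity of Proposition 2 — and the order of vanishing of `R` at `u = 0` is read
off from the `θ`-moments (`PF.coeff_vanish_iff_theta`). -/

/-- The derivation `θ = (u − 1) d/du` of `ℂ⟦u⟧` (`= z d/dz` in `z = 1 − u`), as a linear map.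
[cite: FischlerRivoal2003, §2 Proposition 2 (first proof, `x = log z`) p. 1378] -/
def theta : PowerSeries ℂ →ₗ[ℂ] PowerSeries ℂ where
  toFun F := (PowerSeries.X - 1) * PowerSeries.derivative ℂ F
  map_add' F G := by rw [map_add, mul_add]
  map_smul' c F := by
    rw [(PowerSeries.derivative ℂ).map_smul, RingHom.id_apply, mul_smul_comm]

/-- `θ` applied. [cite: FischlerRivoal2003, §2 Proposition 2 p. 1378] -/
theorem theta_apply (F : PowerSeries ℂ) : theta F = (PowerSeries.X - 1) * PowerSeries.derivative ℂ F := rfl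

/-- `θ` is `ℂ`-linear in the form `θ (C c · F) = C c · θ F`. [cite: FischlerRivoal2003, §2 Proposition 2 p. 1378] -/
theorem theta_C_mul (c : ℂ) (F : PowerSeries ℂ) :
    theta (PowerSeries.C c * F) = PowerSeries.C c * theta F := by
  rw [← PowerSeries.smul_eq_C_mul, map_smul, PowerSeries.smul_eq_C_mul]

/-- Leibniz rule for `θ`. [cite: FischlerRivoal2003, §2 Proposition 2 p. 1378] -/
theorem theta_mul (F G : PowerSeries ℂ) : theta (F * G) = theta F * G + F * theta G := by
  simp only [theta_apply, (PowerSeries.derivative ℂ).leibniz, smul_eq_mul]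
  ring

/-- `θ z^t = t z^t` (`z = 1 − u`). [cite: FischlerRivoal2003, §2 Proposition 2 (first proof) p. 1378] -/
theorem theta_one_sub_X_pow (t : ℕ) :
    theta (((1 : PowerSeries ℂ) - PowerSeries.X) ^ t) =
      PowerSeries.C (t : ℂ) * ((1 : PowerSeries ℂ) - PowerSeries.X) ^ t := by
  rw [theta_apply, (PowerSeries.derivative ℂ).leibniz_pow, map_sub, (PowerSeries.derivative ℂ).map_one_eq_zero,
    PowerSeries.derivative_X, zero_sub, smul_eq_mul, nsmul_eq_mul, map_natCast]
  rcases Nat.eq_zero_or_pos t with rfl | ht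
  · simp
  · obtain ⟨s, rfl⟩ := Nat.exists_eq_add_of_le' ht
    rw [Nat.add_sub_cancel]
    push_cast
    ring

/-- `θ log z = 1` (`log z = log(1 − u) = logFPS`). [cite: FischlerRivoal2003, §2 Proposition 2 (first proof) p. 1378] -/
theorem theta_logFPS : theta logFPS = 1 := by
  rw [theta_apply]
  ext k
  rw [sub_mul, one_mul, map_sub]
  rcases k with _ | k
  · simp [PowerSeries.coeff_zero_X_mul, PowerSeries.coeff_derivative, coeff_logFPS]
  · rw [PowerSeries.coeff_succ_X_mul, PowerSeries.coeff_derivative, PowerSeries.coeff_derivative, coeff_logFPS,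
      coeff_logFPS, PowerSeries.coeff_one, if_neg (Nat.succ_ne_zero k), if_neg (Nat.succ_ne_zero (k + 1)),
      if_neg (Nat.succ_ne_zero k)]
    have h1 : ((k + 1 : ℕ) : ℂ) ≠ 0 := by exact_mod_cast Nat.succ_ne_zero k
    have h2 : ((k + 1 + 1 : ℕ) : ℂ) ≠ 0 := by exact_mod_cast Nat.succ_ne_zero (k + 1)
    field_simp
    push_cast
    ring

/-- `θ log^i z = i log^{i−1} z`. [cite: FischlerRivoal2003, §2 Proposition 2 (first proof) p. 1378] -/
theorem theta_logFPS_pow (i : ℕ) : theta (logFPS ^ i) = PowerSeries.C (i : ℂ) * logFPS ^ (i - 1) := by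
  have h := theta_logFPS
  rw [theta_apply] at h
  rw [theta_apply, (PowerSeries.derivative ℂ).leibniz_pow, smul_eq_mul, nsmul_eq_mul, map_natCast]
  linear_combination ((i : PowerSeries ℂ) * logFPS ^ (i - 1)) * h

/-- The functions `G_{t,i} = z^t log^i(z)/i!` in the variable `u = 1 − z`.
[cite: FischlerRivoal2003, §1 (8) and §2 Proposition 2 p. 1378] -/
def G (t i : ℕ) : PowerSeries ℂ :=
  PowerSeries.C ((i.factorial : ℂ)⁻¹) * (((1 : PowerSeries ℂ) - PowerSeries.X) ^ t * logFPS ^ i)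

/-- `θ G_{t,0} = t G_{t,0}` and `θ G_{t,i+1} = t G_{t,i+1} + G_{t,i}`.
[cite: FischlerRivoal2003, §2 Proposition 2 (first proof) p. 1378] -/
theorem theta_G (t i : ℕ) :
    theta (G t i) = PowerSeries.C (t : ℂ) * G t i + if i = 0 then 0 else G t (i - 1) := by
  unfold G
  rw [theta_C_mul, theta_mul, theta_one_sub_X_pow, theta_logFPS_pow]
  rcases i with _ | i
  · simp
  · rw [if_neg (Nat.succ_ne_zero i), Nat.add_sub_cancel]
    have key : PowerSeries.C (((i + 1).factorial : ℂ)⁻¹) * PowerSeries.C (((i + 1 : ℕ) : ℂ)) =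
        PowerSeries.C ((i.factorial : ℂ)⁻¹) := by
      rw [← map_mul]
      congr 1
      have h : ((i : ℂ) + 1) ≠ 0 := by exact_mod_cast Nat.succ_ne_zero i
      rw [Nat.factorial_succ]
      push_cast
      field_simp
    linear_combination (((1 : PowerSeries ℂ) - PowerSeries.X) ^ t * logFPS ^ i) * key

/-- `constantCoeff G_{t,i} = [i = 0]`. [cite: FischlerRivoal2003, §2 Proposition 2 p. 1378] -/
theorem constantCoeff_G (t i : ℕ) : PowerSeries.constantCoeff (G t i) = if i = 0 then 1 else 0 := by
  have hL : PowerSeries.constantCoeff logFPS = 0 := by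
    rw [← PowerSeries.coeff_zero_eq_constantCoeff_apply, coeff_logFPS, if_pos rfl]
  unfold G
  rw [map_mul, PowerSeries.constantCoeff_C, map_mul, map_pow, map_pow, map_sub, map_one,
    PowerSeries.constantCoeff_X, hL]
  rcases i with _ | i <;> simp

/-- The uniform rule: with `g_ℓ = G_{t,i−ℓ}` (`0` for `ℓ > i`), `θ g_ℓ = t g_ℓ + g_{ℓ+1}`. [folklore] -/
private def gfam (t i l : ℕ) : PowerSeries ℂ := if l ≤ i then G t (i - l) else 0

/-- `θ g_ℓ = t g_ℓ + g_{ℓ+1}` for the uniform family. [folklore] -/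
private theorem theta_gfam (t i l : ℕ) : theta (gfam t i l) = (t : ℂ) • gfam t i l + gfam t i (l + 1) := by
  unfold gfam
  rw [PowerSeries.smul_eq_C_mul]
  by_cases hl : l ≤ i
  · rw [if_pos hl, theta_G]
    by_cases hl' : l + 1 ≤ i
    · rw [if_pos hl', if_neg (by omega : i - l ≠ 0), show i - l - 1 = i - (l + 1) by omega]
    · rw [if_neg hl', if_pos (by omega : i - l = 0)]
  · rw [if_neg hl, if_neg (by omega), map_zero, mul_zero, zero_add]

/-- **Binomial iteration**: if `θ g_ℓ = c g_ℓ + g_{ℓ+1}` for all `ℓ`, then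
`θ^m g_0 = Σ_{ℓ ≤ m} binom(m,ℓ) c^{m−ℓ} g_ℓ`. [folklore] -/
private theorem iterate_of_shift_rule {M : Type*} [AddCommGroup M] [Module ℂ M] (θ : M →ₗ[ℂ] M) (g : ℕ → M)
    (c : ℂ) (h : ∀ l, θ (g l) = c • g l + g (l + 1)) (m : ℕ) :
    θ^[m] (g 0) = ∑ l ∈ range (m + 1), (((m.choose l : ℕ) : ℂ) * c ^ (m - l)) • g l := by
  induction m with
  | zero => simp
  | succ m ih =>
    -- the coefficient families before and after
    set a : ℕ → ℂ := fun l => ((m.choose l : ℕ) : ℂ) * c ^ (m - l) with ha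
    set b : ℕ → ℂ := fun l => (((m + 1).choose l : ℕ) : ℂ) * c ^ (m + 1 - l) with hb
    have e1 : ∀ l ∈ range m, b (l + 1) = a (l + 1) * c + a l := by
      intro l hl
      have hl : l < m := mem_range.mp hl
      simp only [ha, hb, Nat.choose_succ_succ', Nat.cast_add, Nat.add_sub_add_right]
      obtain ⟨d, hd⟩ := Nat.exists_eq_add_of_lt hl
      rw [show m - l = d + 1 by omega, show m - (l + 1) = d by omega, pow_succ]
      ring
    have e2 : b (m + 1) = a m := by simp [ha, hb]
    have e3 : b 0 = a 0 * c := by simp [ha, hb, pow_succ]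
    rw [Function.iterate_succ_apply', ih, map_sum]
    simp only [map_smul, h, smul_add, smul_smul, sum_add_distrib]
    change ∑ l ∈ range (m + 1), (a l * c) • g l + ∑ l ∈ range (m + 1), a l • g (l + 1) =
      ∑ l ∈ range (m + 1 + 1), b l • g l
    have hL1 : ∑ l ∈ range (m + 1), (a l * c) • g l = ∑ l ∈ range m, (a (l + 1) * c) • g (l + 1) + (a 0 * c) • g 0 :=
      sum_range_succ' _ _
    have hL2 : ∑ l ∈ range (m + 1), a l • g (l + 1) = ∑ l ∈ range m, a l • g (l + 1) + a m • g (m + 1) :=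
      sum_range_succ _ _
    have hR : ∑ l ∈ range (m + 1 + 1), b l • g l =
        ∑ l ∈ range m, b (l + 1) • g (l + 1) + b (m + 1) • g (m + 1) + b 0 • g 0 := by
      rw [sum_range_succ', sum_range_succ]
    have hmid : ∑ l ∈ range m, b (l + 1) • g (l + 1) =
        ∑ l ∈ range m, (a (l + 1) * c) • g (l + 1) + ∑ l ∈ range m, a l • g (l + 1) := by
      rw [← sum_add_distrib]
      exact sum_congr rfl fun l hl => by rw [e1 l hl, add_smul]
    rw [hL1, hL2, hR, hmid, e2, e3]
    abel

/-- `constantCoeff` is `ℂ`-homogeneous. [folklore] -/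
private theorem constantCoeff_smul' (x : ℂ) (F : PowerSeries ℂ) :
    PowerSeries.constantCoeff (x • F) = x * PowerSeries.constantCoeff F := by
  rw [PowerSeries.constantCoeff_smul, smul_eq_mul]

/-- `constantCoeff (θ^m G_{t,i}) = binom(m,i) t^{m−i}` (zero for `i > m`).
[cite: FischlerRivoal2003, §2 eq. (17) and Proposition 2 p. 1378] -/
theorem constantCoeff_theta_iterate_G (t i m : ℕ) :
    PowerSeries.constantCoeff (theta^[m] (G t i)) =
      if i ≤ m then ((m.choose i : ℕ) : ℂ) * (t : ℂ) ^ (m - i) else 0 := by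
  have h0 : G t i = gfam t i 0 := by simp [gfam]
  rw [h0, iterate_of_shift_rule theta (gfam t i) (t : ℂ) (theta_gfam t i) m, map_sum]
  simp only [constantCoeff_smul']
  have hcc : ∀ l, PowerSeries.constantCoeff (gfam t i l) = if l = i then 1 else 0 := by
    intro l
    unfold gfam
    by_cases hl : l ≤ i
    · rw [if_pos hl, constantCoeff_G]
      by_cases hli : l = i
      · rw [if_pos (by omega), if_pos hli]
      · rw [if_neg (by omega), if_neg hli]
    · rw [if_neg hl, map_zero, if_neg (by omega)]
  simp only [hcc, mul_ite, mul_one, mul_zero]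
  rw [sum_ite_eq' (range (m + 1)) i]
  simp only [mem_range, Nat.lt_succ_iff]

/-! ### `θ` and the order of vanishing at `u = 0` -/

/-- `θ` preserves "the coefficients below `r` vanish" with `r ↦ r − 1`. [folklore] -/
private theorem coeff_theta_eq_zero_of_lt {F : PowerSeries ℂ} {r : ℕ}
    (hF : ∀ k < r, PowerSeries.coeff k F = 0) : ∀ k < r - 1, PowerSeries.coeff k (theta F) = 0 := by
  intro k hk
  rw [theta_apply, sub_mul, one_mul, map_sub, PowerSeries.coeff_derivative, hF (k + 1) (by omega), zero_mul,
    sub_zero]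
  rcases k with _ | k
  · exact PowerSeries.coeff_zero_X_mul _
  · rw [PowerSeries.coeff_succ_X_mul, PowerSeries.coeff_derivative, hF (k + 1) (by omega), zero_mul]

/-- The first possibly non-zero coefficient after `θ`: `[u^r] θF = −(r+1) [u^{r+1}] F` when `[u^k]F = 0` for `k ≤ r`.
[folklore] -/
private theorem coeff_theta_of_lt {F : PowerSeries ℂ} {r : ℕ} (hF : ∀ k < r + 1, PowerSeries.coeff k F = 0) :
    PowerSeries.coeff r (theta F) = -((r : ℂ) + 1) * PowerSeries.coeff (r + 1) F := by
  rw [theta_apply, sub_mul, one_mul, map_sub, PowerSeries.coeff_derivative]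
  rcases r with _ | r
  · rw [PowerSeries.coeff_zero_X_mul]; push_cast; ring
  · rw [PowerSeries.coeff_succ_X_mul, PowerSeries.coeff_derivative, hF (r + 1) (by omega), zero_mul, zero_sub]
    push_cast; ring

/-- Iterating: `[u^k] θ^m F = 0` for `k < r − m` when `[u^k] F = 0` for `k < r`. [folklore] -/
private theorem coeff_theta_iterate_eq_zero (m : ℕ) :
    ∀ (r : ℕ) (F : PowerSeries ℂ), (∀ k < r, PowerSeries.coeff k F = 0) →
      ∀ k < r - m, PowerSeries.coeff k (theta^[m] F) = 0 := by
  induction m with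
  | zero => intro r F hF k hk; exact hF k (by simpa using hk)
  | succ m ih =>
    intro r F hF k hk
    rw [Function.iterate_succ_apply]
    exact ih (r - 1) (theta F) (coeff_theta_eq_zero_of_lt hF) k (by omega)

/-- The `θ`-moment that detects the order: if `[u^k]F = 0` for `k < r` then
`constantCoeff (θ^r F) = (−1)^r r! [u^r] F`. [folklore] -/
private theorem constantCoeff_theta_iterate_eq (r : ℕ) :
    ∀ (F : PowerSeries ℂ), (∀ k < r, PowerSeries.coeff k F = 0) →
      PowerSeries.constantCoeff (theta^[r] F) = (-1) ^ r * (r.factorial : ℂ) * PowerSeries.coeff r F := by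
  induction r with
  | zero =>
    intro F _
    rw [Function.iterate_zero_apply, pow_zero, Nat.factorial_zero, Nat.cast_one, one_mul, one_mul,
      PowerSeries.coeff_zero_eq_constantCoeff_apply]
  | succ r ih =>
    intro F hF
    rw [Function.iterate_succ_apply, ih (theta F) (coeff_theta_eq_zero_of_lt hF), coeff_theta_of_lt hF,
      Nat.factorial_succ]
    push_cast
    ring

/-- **Order of vanishing through `θ`-moments**: the coefficients `[u^k]F`, `k < M`, all vanish iff the constant
terms of `F, θF, …, θ^{M−1}F` all vanish (`θ` lowers the order by exactly one, characteristic zero).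
[cite: FischlerRivoal2003, Lemme 3 with Proposition 2 p. 1377–1378] -/
theorem coeff_vanish_iff_theta (F : PowerSeries ℂ) (M : ℕ) :
    (∀ k < M, PowerSeries.coeff k F = 0) ↔ ∀ m < M, PowerSeries.constantCoeff (theta^[m] F) = 0 := by
  constructor
  · intro h m hm
    have := coeff_theta_iterate_eq_zero m M F h 0 (by omega)
    rwa [PowerSeries.coeff_zero_eq_constantCoeff_apply] at this
  · induction M with
    | zero => intro _ k hk; exact absurd hk (Nat.not_lt_zero k)
    | succ M ih =>
      intro h k hk
      have hlow : ∀ k < M, PowerSeries.coeff k F = 0 := ih fun m hm => h m (by omega)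
      rcases Nat.lt_succ_iff_lt_or_eq.mp hk with hk' | rfl
      · exact hlow k hk'
      · have hM := constantCoeff_theta_iterate_eq k F hlow
        rw [h k (Nat.lt_succ_self k)] at hM
        have hne : (-1 : ℂ) ^ k * (k.factorial : ℂ) ≠ 0 :=
          mul_ne_zero (pow_ne_zero _ (by norm_num)) (by exact_mod_cast k.factorial_ne_zero)
        exact (mul_eq_zero.mp hM.symm).resolve_left hne

end PF

/-! ## The three expansions of `IsPadeSolution` in terms of the array `p_{j,t}` -/

/-- The array `p o t = p_{o+1,t}` of coefficients of `P_1, …, P_a` ("`P_j(z) = Σ_{t=0}^{n} p_{j,t} z^t`").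
[cite: FischlerRivoal2003, §2 (beginning of the proof of Théorème 1) p. 1376] -/
def arr (P : ℕ → ℂ[X]) : ℕ → ℕ → ℂ := fun o t => (P (o + 1)).coeff t

/-- `Σ_{j ∈ [1,a]} f(j) = Σ_{o < a} f(o+1)`. [folklore] -/
private theorem sum_Icc_one (a : ℕ) {M : Type*} [AddCommMonoid M] (f : ℕ → M) :
    ∑ j ∈ Icc 1 a, f j = ∑ o ∈ range a, f (o + 1) := by
  induction a with
  | zero => simp
  | succ a ih => rw [sum_Icc_succ_top (by omega), ih, sum_range_succ]

/-- The degree hypothesis of `IsPadeSolution` at `j = o + 1`, `o < a`. [folklore] -/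
private theorem natDegree_of_mem {n a : ℕ} {P : ℕ → ℂ[X]} (hP : ∀ j ∈ Icc 1 a, (P j).natDegree ≤ n) {o : ℕ}
    (ho : o ∈ range a) : (P (o + 1)).natDegree ≤ n :=
  hP (o + 1) (by rw [mem_Icc]; have := mem_range.mp ho; omega)

/-- **(13): the coefficient of `z^{−k}` (`k ≥ 1`) in `S(z)` is `A(k)`.** In the tree's variable `w = 1/z` after
multiplication by `wⁿ`: `[w^{n+k}] expansionAtInfinity = A(k)`.
[cite: FischlerRivoal2003, §2 eq. (13)–(14) p. 1376] -/
theorem coeff_expansionAtInfinity_add {n a : ℕ} {P₀ : ℂ[X]} {P : ℕ → ℂ[X]} (hP₀ : P₀.natDegree ≤ n)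
    (hP : ∀ j ∈ Icc 1 a, (P j).natDegree ≤ n) {k : ℕ} (hk : 1 ≤ k) :
    PowerSeries.coeff (n + k) (expansionAtInfinity n a P₀ P) = PF.aval n a (arr P) (k : ℂ) := by
  unfold expansionAtInfinity PF.aval
  rw [map_add, Polynomial.coeff_coe, coeff_reflect, revAt_eq_self_of_lt (by omega : n < n + k),
    coeff_eq_zero_of_natDegree_lt (by omega : P₀.natDegree < n + k), zero_add, map_sum, sum_Icc_one]
  refine sum_congr rfl fun o ho => ?_
  have hPo : (P (o + 1)).natDegree ≤ n := natDegree_of_mem hP ho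
  rw [PowerSeries.coeff_mul, Nat.sum_antidiagonal_eq_sum_range_succ (fun i j =>
    PowerSeries.coeff i ((reflect n (P (o + 1)) : ℂ[X]) : PowerSeries ℂ) * PowerSeries.coeff j (polylogFPS (o + 1))),
    Nat.succ_eq_add_one, show n + k + 1 = (n + 1) + k by ring, sum_range_add]
  have hzero : ∑ x ∈ range k, PowerSeries.coeff (n + 1 + x) ((reflect n (P (o + 1)) : ℂ[X]) : PowerSeries ℂ) *
      PowerSeries.coeff (n + k - (n + 1 + x)) (polylogFPS (o + 1)) = 0 := by
    refine sum_eq_zero fun x _ => ?_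
    rw [Polynomial.coeff_coe, coeff_reflect, revAt_eq_self_of_lt (by omega : n < n + 1 + x),
      coeff_eq_zero_of_natDegree_lt (by omega), zero_mul]
  rw [hzero, add_zero, ← sum_range_reflect]
  refine sum_congr rfl fun t ht => ?_
  have ht' : t < n + 1 := mem_range.mp ht
  rw [Polynomial.coeff_coe, coeff_reflect, revAt_le (by omega : n + 1 - 1 - t ≤ n), coeff_polylogFPS,
    if_neg (by omega), show n - (n + 1 - 1 - t) = t by omega, arr, Nat.cast_sub (by omega : n + 1 - 1 - t ≤ n + k),
    Nat.cast_sub (by omega : t ≤ n + 1 - 1)]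
  push_cast
  have e : ((n : ℂ) + k - (n - t)) = (k : ℂ) + t := by ring
  rw [e]
  ring

/-- **(15): the coefficient of `z^{−k}` (`k ≥ 1`) in `S̄` is `A(−k−n)`,** i.e. `[z^{n+k}] expansionAtZero = A(−n−k)`.
[cite: FischlerRivoal2003, Lemme 2 eq. (15) p. 1377] -/
theorem coeff_expansionAtZero_add {n a : ℕ} {Pbar₀ : ℂ[X]} {P : ℕ → ℂ[X]} (hPbar₀ : Pbar₀.natDegree ≤ n)
    (hP : ∀ j ∈ Icc 1 a, (P j).natDegree ≤ n) {k : ℕ} (hk : 1 ≤ k) :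
    PowerSeries.coeff (n + k) (expansionAtZero a Pbar₀ P) = PF.aval n a (arr P) (-(n : ℂ) - k) := by
  unfold expansionAtZero PF.aval
  rw [map_add, Polynomial.coeff_coe, coeff_eq_zero_of_natDegree_lt (by omega : Pbar₀.natDegree < n + k), zero_add,
    map_sum, sum_Icc_one]
  refine sum_congr rfl fun o ho => ?_
  have hPo : (P (o + 1)).natDegree ≤ n := natDegree_of_mem hP ho
  rw [PowerSeries.coeff_smul, PowerSeries.coeff_mul, Nat.sum_antidiagonal_eq_sum_range_succ (fun i j =>
    PowerSeries.coeff i ((P (o + 1) : ℂ[X]) : PowerSeries ℂ) * PowerSeries.coeff j (polylogFPS (o + 1))),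
    Nat.succ_eq_add_one, show n + k + 1 = (n + 1) + k by ring, sum_range_add]
  have hzero : ∑ x ∈ range k, PowerSeries.coeff (n + 1 + x) ((P (o + 1) : ℂ[X]) : PowerSeries ℂ) *
      PowerSeries.coeff (n + k - (n + 1 + x)) (polylogFPS (o + 1)) = 0 := by
    refine sum_eq_zero fun x _ => ?_
    rw [Polynomial.coeff_coe, coeff_eq_zero_of_natDegree_lt (by omega), zero_mul]
  rw [hzero, add_zero, smul_eq_mul, mul_sum]
  refine sum_congr rfl fun t ht => ?_
  have ht' : t < n + 1 := mem_range.mp ht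
  rw [Polynomial.coeff_coe, coeff_polylogFPS, if_neg (by omega), arr, Nat.cast_sub (by omega : t ≤ n + k)]
  push_cast
  have hne : ((n : ℂ) + k - t) ≠ 0 := by
    have h1 : ((n + k - t : ℕ) : ℂ) ≠ 0 := by exact_mod_cast (show n + k - t ≠ 0 by omega)
    rw [Nat.cast_sub (by omega : t ≤ n + k)] at h1
    push_cast at h1
    exact h1
  have hm1 : ((-1 : ℂ) ^ (o + 1)) * (-1) ^ (o + 1) = 1 := by
    rw [← mul_pow]; norm_num
  rw [show (-(n : ℂ) - k + t) = (-1) * ((n : ℂ) + k - t) by ring, mul_pow]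
  field_simp
  linear_combination ((P (o + 1)).coeff t) * hm1

/-- The polynomial part `P_j(1−u)` of `expansionAtOne` in the basis `(1−u)^t`.
[cite: FischlerRivoal2003, §1 (8) p. 1373] -/
private theorem coe_comp_one_sub_X {q : ℂ[X]} {n : ℕ} (hq : q.natDegree ≤ n) :
    (((q.comp (1 - X) : ℂ[X])) : PowerSeries ℂ) =
      ∑ t ∈ range (n + 1), PowerSeries.C (q.coeff t) * ((1 : PowerSeries ℂ) - PowerSeries.X) ^ t := by
  conv_lhs => rw [as_sum_range' q (n + 1) (by omega)]
  simp only [Polynomial.sum_comp, ← C_mul_X_pow_eq_monomial, mul_comp, C_comp, X_pow_comp]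
  rw [PF.coe_finset_sum]
  refine sum_congr rfl fun t _ => ?_
  rw [Polynomial.coe_mul, Polynomial.coe_C, Polynomial.coe_pow, Polynomial.coe_sub, Polynomial.coe_one,
    Polynomial.coe_X]

/-- `R` in the basis `G_{t,i}`: `expansionAtOne = Σ_{o<a} Σ_{t≤n} (−1)^o p_{o+1,t} G_{t,o}`.
[cite: FischlerRivoal2003, §1 (8) p. 1373 and §2 Proposition 2 (first proof) p. 1378] -/
theorem expansionAtOne_eq_sum_G {n a : ℕ} {P : ℕ → ℂ[X]} (hP : ∀ j ∈ Icc 1 a, (P j).natDegree ≤ n) :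
    expansionAtOne a P =
      ∑ o ∈ range a, ∑ t ∈ range (n + 1), PowerSeries.C ((-1) ^ o * arr P o t) * PF.G t o := by
  unfold expansionAtOne
  rw [sum_Icc_one]
  refine sum_congr rfl fun o ho => ?_
  have hPo : (P (o + 1)).natDegree ≤ n := natDegree_of_mem hP ho
  rw [Nat.add_sub_cancel, coe_comp_one_sub_X hPo, sum_mul, PowerSeries.smul_eq_C_mul, mul_sum]
  refine sum_congr rfl fun t _ => ?_
  rw [PF.G, arr]
  have hc : PowerSeries.C ((-1 : ℂ) ^ o / (o.factorial : ℂ)) * PowerSeries.C ((P (o + 1)).coeff t) =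
      PowerSeries.C ((-1) ^ o * (P (o + 1)).coeff t) * PowerSeries.C ((o.factorial : ℂ)⁻¹) := by
    rw [← map_mul, ← map_mul]
    congr 1
    rw [div_eq_mul_inv]
    ring
  linear_combination (((1 : PowerSeries ℂ) - PowerSeries.X) ^ t * logFPS ^ o) * hc

/-- **Proposition 2 as a coefficient identity**: `constantCoeff (θ^m R) = (−1)^m A_{m+1}` with the `A_d` of (17)
(`A_{m+1} = [v^{m+1}] Â`). [cite: FischlerRivoal2003, Proposition 2 and eq. (17) p. 1378] -/
theorem constantCoeff_theta_iterate_expansionAtOne {n a : ℕ} {P : ℕ → ℂ[X]}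
    (hP : ∀ j ∈ Icc 1 a, (P j).natDegree ≤ n) (m : ℕ) :
    PowerSeries.constantCoeff (PF.theta^[m] (expansionAtOne a P)) =
      (-1) ^ m * PowerSeries.coeff (m + 1) (PF.hat n a (arr P)) := by
  rw [expansionAtOne_eq_sum_G hP, PF.coeff_hat, mul_sum]
  have hlin : ∀ (s : Finset ℕ) (f : ℕ → PowerSeries ℂ),
      PF.theta^[m] (∑ i ∈ s, f i) = ∑ i ∈ s, PF.theta^[m] (f i) := by
    intro s f
    rw [← Module.End.pow_apply, map_sum]
    exact sum_congr rfl fun i _ => (Module.End.pow_apply _ _ _)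
  have hsm : ∀ (c : ℂ) (f : PowerSeries ℂ), PF.theta^[m] (PowerSeries.C c * f) = PowerSeries.C c * PF.theta^[m] f := by
    intro c f
    rw [← PowerSeries.smul_eq_C_mul, ← Module.End.pow_apply, map_smul, Module.End.pow_apply,
      PowerSeries.smul_eq_C_mul]
  rw [hlin, map_sum]
  refine sum_congr rfl fun o ho => ?_
  rw [hlin, map_sum, mul_sum]
  refine sum_congr rfl fun t ht => ?_
  rw [hsm, map_mul, PowerSeries.constantCoeff_C, PF.constantCoeff_theta_iterate_G, Nat.add_sub_cancel]
  by_cases hom : o ≤ m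
  · rw [if_pos hom, if_pos (by omega)]
    have hsgn : (-1 : ℂ) ^ m * (-(t : ℂ)) ^ (m - o) = (-1) ^ o * (t : ℂ) ^ (m - o) := by
      rw [neg_pow (t : ℂ) (m - o), ← mul_assoc, ← pow_add]
      obtain ⟨d, rfl⟩ := Nat.exists_eq_add_of_le hom
      rw [Nat.add_sub_cancel_left, show o + d + d = o + 2 * d by ring, pow_add, pow_mul, neg_one_sq, one_pow,
        mul_one]
    linear_combination (arr P o t * ((m.choose o : ℕ) : ℂ)) * hsgn.symm
  · rw [if_neg hom, if_neg (by omega), mul_zero, mul_zero]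

/-- **Lemme 3** (dictionary form, both directions): the coefficients of `u^0, …, u^{M−1}` of `R(1−u)` vanish iff
`deg Q ≤ a(n+1) − 1 − M` ("`deg(Q) ≤ D` si, et seulement si, … `R(z) = O((1−z)^{a(n+1)−D−1})`", with
`D = a(n+1) − 1 − M`). [cite: FischlerRivoal2003, Lemme 3 p. 1377] -/
theorem atOne_iff_natDegree_le {n a : ℕ} (ha : 1 ≤ a) {P : ℕ → ℂ[X]} (hP : ∀ j ∈ Icc 1 a, (P j).natDegree ≤ n)
    {M : ℕ} (hM : M + 1 ≤ a * (n + 1)) :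
    (∀ k < M, PowerSeries.coeff k (expansionAtOne a P) = 0) ↔
      (PF.poly n a (arr P)).natDegree ≤ a * (n + 1) - 1 - M := by
  rw [PF.coeff_vanish_iff_theta, PF.natDegree_poly_le_iff_le_order_hat ha,
    show a * (n + 1) - (a * (n + 1) - 1 - M) = M + 1 by omega]
  simp only [constantCoeff_theta_iterate_expansionAtOne hP, mul_eq_zero, pow_eq_zero_iff', neg_eq_zero,
    one_ne_zero, ne_eq, false_and, false_or]
  constructor
  · intro h
    refine PowerSeries.nat_le_order _ _ fun d hd => ?_
    rcases d with _ | d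
    · exact PF.coeff_zero_hat n a _
    · exact h d (by omega)
  · intro h m hm
    exact PowerSeries.coeff_of_lt_order (m + 1) (lt_of_lt_of_le (by exact_mod_cast (show m + 1 < M + 1 by omega)) h)

/-- **Lemme 1** (dictionary form): the coefficient of `z^{−k}` in `S(z)`, `1 ≤ k`, vanishes iff `Q(k) = 0` ("`A`
s'annule aux points `1, …, ρ`"). [cite: FischlerRivoal2003, Lemme 1 p. 1376] -/
theorem coeff_expansionAtInfinity_eq_zero_iff {n a : ℕ} {P₀ : ℂ[X]} {P : ℕ → ℂ[X]} (hP₀ : P₀.natDegree ≤ n)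
    (hP : ∀ j ∈ Icc 1 a, (P j).natDegree ≤ n) {k : ℕ} (hk : 1 ≤ k) :
    PowerSeries.coeff (n + k) (expansionAtInfinity n a P₀ P) = 0 ↔ (PF.poly n a (arr P)).eval (k : ℂ) = 0 := by
  have hk' : ∀ t : ℕ, t ≤ n → (k : ℂ) + t ≠ 0 := fun t _ => by
    exact_mod_cast (show k + t ≠ 0 by omega)
  rw [coeff_expansionAtInfinity_add hP₀ hP hk, ← PF.aval_mul_den (arr P) (k : ℂ) hk']
  have hden : PF.den n a (k : ℂ) ≠ 0 := prod_ne_zero_iff.mpr fun t ht => pow_ne_zero _ (hk' t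
    (Nat.lt_succ_iff.mp (mem_range.mp ht)))
  rw [mul_eq_zero, or_iff_left hden]

/-- **Lemme 2** (dictionary form): the coefficient of `z^{n+k}` in `S̄(z)`, `1 ≤ k`, vanishes iff `Q(−n−k) = 0`
("l'annulation de `A` en `−n−1, …, −n−σ`"). [cite: FischlerRivoal2003, Lemme 2 p. 1377] -/
theorem coeff_expansionAtZero_eq_zero_iff {n a : ℕ} {Pbar₀ : ℂ[X]} {P : ℕ → ℂ[X]} (hPbar₀ : Pbar₀.natDegree ≤ n)
    (hP : ∀ j ∈ Icc 1 a, (P j).natDegree ≤ n) {k : ℕ} (hk : 1 ≤ k) :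
    PowerSeries.coeff (n + k) (expansionAtZero a Pbar₀ P) = 0 ↔
      (PF.poly n a (arr P)).eval (-(n : ℂ) - k) = 0 := by
  have hk' : ∀ t : ℕ, t ≤ n → (-(n : ℂ) - k) + t ≠ 0 := by
    intro t ht h
    have h1 : ((n + k - t : ℕ) : ℂ) = 0 := by
      rw [Nat.cast_sub (by omega)]; push_cast; linear_combination -h
    have h2 : n + k - t = 0 := by exact_mod_cast h1
    omega
  rw [coeff_expansionAtZero_add hPbar₀ hP hk, ← PF.aval_mul_den (arr P) _ hk']
  have hden : PF.den n a (-(n : ℂ) - k) ≠ 0 := prod_ne_zero_iff.mpr fun t ht => pow_ne_zero _ (hk' t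
    (Nat.lt_succ_iff.mp (mem_range.mp ht)))
  rw [mul_eq_zero, or_iff_left hden]

end Literature.NumberTheory.Irrationality.FischlerRivoal2003
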